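import Summits.AtomisticToContinuum.BoseEinsteinCondensation.Theses.BECStronglyRayleigh
import Summits.AtomisticToContinuum.BoseEinsteinCondensation.Theorems.InsertionFieldDelocalisation.Negative.Toolkit
import Summits.AtomisticToContinuum.BoseEinsteinCondensation.Theorems.InsertionFieldDelocalisation.Negative.Tightness
import Summits.AtomisticToContinuum.BoseEinsteinCondensation.Theorems.InsertionFieldDelocalisation.Negative.PerronExistence
import Summits.AtomisticToContinuum.BoseEinsteinCondensation.Theorems.BECStronglyRayleighInsertionFieldDelocalisationEmbedding
import Literature.MathematicalPhysics.QuantumLattice.FinDimSpectrumSectorGibbsLimit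
import Summits.AtomisticToContinuum.BoseEinsteinCondensation.Theorems.InsertionFieldDelocalisation.Negative.TorusDegreePairEnergy
import HarnessLib

/-!
# Negative lemmas for crux `InsertionFieldDelocalisation` (stmt-AtomisticToContinuum-9673), IX:
# line `cosh-budget-penrose-onsager` — the Penrose–Onsager budget needs the eigen-equation of `ψ'`

Supports (does not close) stmt-AtomisticToContinuum-9673; nothing here asserts a Theses statement or a
stub (drefute seat; the lead's def-free skeleton
`Cruxes/InsertionFieldDelocalisation/Lines/cosh_budget_penrose_onsager.lean`, stub `stub_poExcessBudget`:
`⟨Φ,HΦ⟩ - E(N+1)‖Φ‖² ≤ C_B‖Φ‖²/L³` for the PO vector `Φ = A†ψ'` of an admissible level-`N` datum `ψ'`).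

* `poExcessBudget_false_without_groundState` — delete the eigen-equation of `ψ'` (keep sector,
  `ψ' ≠ 0`, entrywise real nonnegative): FALSE.  Witness `N = 1`, `ψ' = δ_{1_{{0}}}` (one frozen
  boson): `Φ` is the indicator of the two-sets `{0, x}`, `x ≠ 0`; only the free boson hops, so
  `⟨Φ,HΦ⟩ ≥ -3‖Φ‖²` (`torus_degree_le_six`), while `E(2) ≤ -5` (`lowestEnergy_two_le_neg_five`): the
  excess is `≥ 2‖Φ‖²`, which beats `C_B‖Φ‖²/L³` once `L³ > C_B/2`.  So any proof of the budget must use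
  that `ψ'` is a GROUND vector ("a flat boson into the ground state"), not merely an admissible
  nonnegative sector vector — in line with the card's reading of the budget as a variational
  statement of `O(L⁻³)` absolute precision.
-/

noncomputable section

namespace Summit.AtomisticToContinuum.BoseEinsteinCondensation.Theorems.InsertionFieldDelocalisation.Negative

open scoped BigOperators ComplexOrder
open Literature.MathematicalPhysics.QuantumLattice Literature.Probability.LatticeModels Matrix Finset
open Summit.AtomisticToContinuum.BoseEinsteinCondensation.Theses.BECStronglyRayleigh

/-! ### `stub_poExcessBudget` of line `cosh-budget-penrose-onsager` needs the eigen-equation of `ψ'` -/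

/-- **Any proof of `stub_poExcessBudget` must use that `ψ'` is a ground vector.** Delete the
eigen-equation from the admissibility of `ψ'` (keep: sector, `ψ' ≠ 0`, entrywise real nonnegative)
and the `O(L⁻³)` Penrose–Onsager budget is FALSE. Witness: `N = 1`, `ψ' = δ_{1_{{0}}}` (one frozen
boson); its PO vector `Φ = A†ψ'` is the indicator of the two-sets `{0, x}`, `x ≠ 0`, so
`⟨Φ,HΦ⟩ ≥ -3‖Φ‖²` (only the free boson hops: at most six moves, `torus_degree_le_six`), while
`E(2) ≤ -5` (`lowestEnergy_two_le_neg_five`): the excess is `≥ 2‖Φ‖²`, not `≤ C_B‖Φ‖²/L³`.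
(Statement = the registered def-free `stub_poExcessBudget` with the conjunct
`(xyTorus 3 L 1).mulVec ψ' = E(N) • ψ'` removed.) [folklore] -/
theorem poExcessBudget_false_without_groundState : ¬
    (∃ C_B : ℝ, 0 ≤ C_B ∧ ∀ (L : ℕ) [NeZero L], 3 ≤ L → ∀ N : ℕ, 1 ≤ N → 2 * (N + 1) ≤ L ^ 3 →
      ∀ ψ' : TensorIndex (TorusSite 3 L) 2 → ℂ,
        (ψ' ∈ spinZSector 1 (((N : ℕ) : ℝ) - (L : ℝ) ^ 3 / 2) ∧ ψ' ≠ 0 ∧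
          ∀ σ, 0 ≤ (ψ' σ).re ∧ (ψ' σ).im = 0) →
        (star ((fun σ => ∑ x, if σ x = 0 then (ψ') (Function.update σ x 1) else 0)) ⬝ᵥ
            (xyTorus 3 L 1).mulVec
              ((fun σ => ∑ x, if σ x = 0 then (ψ') (Function.update σ x 1) else 0))).re -
          lowestEnergyInSector 1 (xyTorus 3 L 1) (((N + 1 : ℕ) : ℝ) - (L : ℝ) ^ 3 / 2) *
            (star ((fun σ => ∑ x, if σ x = 0 then (ψ') (Function.update σ x 1) else 0)) ⬝ᵥ
              ((fun σ => ∑ x, if σ x = 0 then (ψ') (Function.update σ x 1) else 0))).re ≤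
          C_B / (L : ℝ) ^ 3 *
            (star ((fun σ => ∑ x, if σ x = 0 then (ψ') (Function.update σ x 1) else 0)) ⬝ᵥ
              ((fun σ => ∑ x, if σ x = 0 then (ψ') (Function.update σ x 1) else 0))).re) := by
  rintro ⟨C_B, -, h⟩
  -- a large side `L ≥ 3` with `L³ > C_B / 2`
  obtain ⟨L, hL2, hLM⟩ := exists_side_gt (max (C_B / 2) 9)
  have hL9 : (9 : ℝ) < (L : ℝ) ^ 3 := lt_of_le_of_lt (le_max_right _ _) hLM
  have hLC : C_B / 2 < (L : ℝ) ^ 3 := lt_of_le_of_lt (le_max_left _ _) hLM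
  have hL3 : 3 ≤ L := by
    by_contra h3
    have hL' : L = 2 := by omega
    rw [hL'] at hL9
    norm_num at hL9
  haveI : NeZero L := ⟨by omega⟩
  have hL27 : 2 * (1 + 1) ≤ L ^ 3 :=
    calc 2 * (1 + 1) ≤ 3 ^ 3 := by norm_num
      _ ≤ L ^ 3 := Nat.pow_le_pow_left hL3 3
  -- the frozen boson at the origin
  set k : TorusSite 3 L := 0 with hk
  set ψ' : TensorIndex (TorusSite 3 L) 2 → ℂ :=
    bvec (fun z => if z ∈ ({k} : Finset (TorusSite 3 L)) then (0 : Fin 2) else 1) with hψ'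
  have hsec : ψ' ∈ spinZSector 1 ((((1 : ℕ) : ℕ) : ℝ) - (L : ℝ) ^ 3 / 2) := by
    refine bvec_ind_mem_spinZSector _ _ ?_
    rw [Finset.card_singleton, card_torusSite 3 L]
    push_cast
    ring
  have key := h L hL3 1 le_rfl hL27 ψ' ⟨hsec, bvec_ne_zero _, bvec_nonneg _⟩
  set Φ : TensorIndex (TorusSite 3 L) 2 → ℂ :=
    fun σ => ∑ x, if σ x = 0 then ψ' (Function.update σ x 1) else 0 with hΦ
  change (star Φ ⬝ᵥ (xyTorus 3 L 1 *ᵥ Φ)).re -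
      lowestEnergyInSector 1 (xyTorus 3 L 1) (((1 + 1 : ℕ) : ℝ) - (L : ℝ) ^ 3 / 2) *
        (star Φ ⬝ᵥ Φ).re ≤ C_B / (L : ℝ) ^ 3 * (star Φ ⬝ᵥ Φ).re at key
  -- the pair configurations `τ x = 1_{{x, k}}` and their set `T`
  set τ : TorusSite 3 L → TensorIndex (TorusSite 3 L) 2 :=
    fun x => fun z => if z ∈ insert x ({k} : Finset (TorusSite 3 L)) then (0 : Fin 2) else 1 with hτ
  set T : Finset (TensorIndex (TorusSite 3 L) 2) := (Finset.univ.erase k).image τ with hT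
  -- `Φ σ` counts the sites `x` with `σ x = 0` and `σ` emptied at `x` equal to `1_{{k}}`
  have hΦval : ∀ σ, Φ σ = ((Finset.univ.filter fun x => σ x = 0 ∧
      Function.update σ x 1 = fun z => if z ∈ ({k} : Finset (TorusSite 3 L)) then (0 : Fin 2) else 1).card : ℂ) := by
    intro σ
    simp only [hΦ, hψ', bvec_apply]
    rw [← Finset.sum_boole]
    refine Finset.sum_congr rfl fun x _ => ?_
    split_ifs <;> first | rfl | (exfalso; tauto)
  -- at most one such site
  have hA1 : ∀ σ, (Finset.univ.filter fun x => σ x = 0 ∧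
      Function.update σ x 1 = fun z => if z ∈ ({k} : Finset (TorusSite 3 L)) then (0 : Fin 2) else 1).card ≤ 1 := by
    intro σ
    refine Finset.card_le_one.mpr fun x hx x' hx' => ?_
    rw [Finset.mem_filter] at hx hx'
    by_contra hne
    have h1 := congrFun hx.2.2 x
    have h2 := congrFun hx'.2.2 x
    rw [Function.update_self] at h1
    rw [Function.update_of_ne hne, hx.2.1] at h2
    rw [← h2] at h1
    exact absurd h1 (by decide)
  -- membership facts
  have hAτ : ∀ x, x ≠ k → x ∈ (Finset.univ.filter fun y => τ x y = 0 ∧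
      Function.update (τ x) y 1 = fun z => if z ∈ ({k} : Finset (TorusSite 3 L)) then (0 : Fin 2) else 1) := by
    intro x hxk
    rw [Finset.mem_filter]
    refine ⟨Finset.mem_univ _, by simp [hτ], ?_⟩
    funext z
    by_cases hz : z = x
    · subst hz
      rw [Function.update_self]
      simp [hxk]
    · rw [Function.update_of_ne hz]
      simp [hτ, hz]
  have hAσ : ∀ σ x, x ∈ (Finset.univ.filter fun y => σ y = 0 ∧
      Function.update σ y 1 = fun z => if z ∈ ({k} : Finset (TorusSite 3 L)) then (0 : Fin 2) else 1) →
      x ≠ k ∧ σ = τ x := by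
    intro σ x hx
    rw [Finset.mem_filter] at hx
    obtain ⟨-, hx0, hup⟩ := hx
    have hxk : x ≠ k := by
      intro hxk
      have := congrFun hup x
      rw [Function.update_self, hxk] at this
      simp at this
    refine ⟨hxk, funext fun z => ?_⟩
    by_cases hz : z = x
    · subst hz
      rw [hx0]
      simp [hτ]
    · have := congrFun hup z
      rw [Function.update_of_ne hz] at this
      rw [this]
      simp [hτ, hz]
  -- hence `Φ` is the indicator of `T`
  have hΦT : ∀ σ, Φ σ = if σ ∈ T then 1 else 0 := by
    intro σ
    rw [hΦval]
    by_cases hσ : σ ∈ T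
    · rw [if_pos hσ]
      obtain ⟨x, hx, rfl⟩ := Finset.mem_image.mp hσ
      have hxk : x ≠ k := Finset.ne_of_mem_erase hx
      have hle := hA1 (τ x)
      have hge : 1 ≤ (Finset.univ.filter fun y => τ x y = 0 ∧
          Function.update (τ x) y 1 = fun z => if z ∈ ({k} : Finset (TorusSite 3 L)) then (0 : Fin 2) else 1).card :=
        Finset.card_pos.mpr ⟨x, hAτ x hxk⟩
      have : (Finset.univ.filter fun y => τ x y = 0 ∧
          Function.update (τ x) y 1 = fun z => if z ∈ ({k} : Finset (TorusSite 3 L)) then (0 : Fin 2) else 1).card = 1 := by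
        omega
      rw [this]; simp
    · rw [if_neg hσ]
      have : (Finset.univ.filter fun y => σ y = 0 ∧
          Function.update σ y 1 = fun z => if z ∈ ({k} : Finset (TorusSite 3 L)) then (0 : Fin 2) else 1) = ∅ := by
        by_contra hne
        obtain ⟨x, hx⟩ := Finset.nonempty_iff_ne_empty.mpr hne
        obtain ⟨hxk, rfl⟩ := hAσ σ x hx
        exact hσ (Finset.mem_image.mpr ⟨x, Finset.mem_erase.mpr ⟨hxk, Finset.mem_univ _⟩, rfl⟩)
      rw [this]; simp
  -- `‖Φ‖² = #T`
  have hns : star Φ ⬝ᵥ Φ = (T.card : ℂ) := by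
    rw [dotProduct]
    have hterm : ∀ σ : TensorIndex (TorusSite 3 L) 2, star Φ σ * Φ σ = if σ ∈ T then (1 : ℂ) else 0 := by
      intro σ
      rw [Pi.star_apply, hΦT σ]
      split_ifs <;> simp
    rw [Finset.sum_congr rfl fun σ _ => hterm σ, Finset.sum_boole]
    congr 1
    congr 1
    ext σ
    simp
  -- `Re (HΦ)(τ x) ≥ -3` for `x ≠ k`: only the free boson hops
  have hrow : ∀ x, x ≠ k → -3 ≤ ((xyTorus 3 L 1 *ᵥ Φ) (τ x)).re := by
    intro x hxk
    have hτx : τ x = fun z => if z ∈ insert x ({k} : Finset (TorusSite 3 L)) then (0 : Fin 2) else 1 := rfl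
    rw [hτx, show xyTorus 3 L 1 = xxzHamiltonian 1 (torusGraph 3 L) (-1) 0 from rfl,
      Cruxes.InsertionFieldDelocalisation.MobileTrapDirichletEigenfunction.mt3em_xxzZero_mulVec_ind]
    set S : Finset (TorusSite 3 L) := insert x {k} with hS
    -- the summands as real indicators
    have hterm : ∀ a ∈ S, ∀ b : TorusSite 3 L,
        (if b ∉ S ∧ (torusGraph 3 L).Adj a b then
          Φ (fun z => if z ∈ insert b (S.erase a) then 0 else 1) else 0) =
        ((if (b ∉ S ∧ (torusGraph 3 L).Adj a b) ∧
            (fun z => if z ∈ insert b (S.erase a) then (0 : Fin 2) else 1) ∈ T then (1 : ℝ) else 0 : ℝ) : ℂ) := by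
      intro a _ b
      rw [hΦT]
      by_cases h1 : b ∉ S ∧ (torusGraph 3 L).Adj a b
      · by_cases h2 : (fun z => if z ∈ insert b (S.erase a) then (0 : Fin 2) else 1) ∈ T
        · rw [if_pos h1, if_pos h2, if_pos ⟨h1, h2⟩]; simp
        · rw [if_pos h1, if_neg h2, if_neg (fun h => h2 h.2)]; simp
      · rw [if_neg h1, if_neg (fun h => h1 h.1)]; simp
    rw [Finset.sum_congr rfl fun a ha => Finset.sum_congr rfl fun b _ => hterm a ha b]
    have hcast : (∑ a ∈ S, ∑ b : TorusSite 3 L,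
        (((if (b ∉ S ∧ (torusGraph 3 L).Adj a b) ∧
            (fun z => if z ∈ insert b (S.erase a) then (0 : Fin 2) else 1) ∈ T then (1 : ℝ) else 0 : ℝ)) : ℂ)) =
        ((∑ a ∈ S, ∑ b : TorusSite 3 L,
          (if (b ∉ S ∧ (torusGraph 3 L).Adj a b) ∧
            (fun z => if z ∈ insert b (S.erase a) then (0 : Fin 2) else 1) ∈ T then (1 : ℝ) else 0) : ℝ) : ℂ) := by
      rw [Complex.ofReal_sum]
      exact Finset.sum_congr rfl fun a _ => (Complex.ofReal_sum _ _).symm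
    rw [hcast, ← Complex.ofReal_mul, Complex.ofReal_re]
    -- the double sum is at most `6`: the `a = k` terms vanish, the `a = x` terms are `≤ deg x ≤ 6`
    have hxS : (insert x ({k} : Finset (TorusSite 3 L))).erase k = {x} := by
      rw [Finset.erase_insert_of_ne hxk, Finset.erase_singleton]
      rfl
    have hkterm : ∀ b : TorusSite 3 L,
        (if (b ∉ S ∧ (torusGraph 3 L).Adj k b) ∧
            (fun z => if z ∈ insert b (S.erase k) then (0 : Fin 2) else 1) ∈ T then (1 : ℝ) else 0) = 0 := by
      intro b
      rw [if_neg]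
      rintro ⟨⟨hbS, -⟩, hmem⟩
      rw [hS, hxS] at hmem
      obtain ⟨y, hy, hyeq⟩ := Finset.mem_image.mp hmem
      have hsets : insert y ({k} : Finset (TorusSite 3 L)) = insert b {x} := (ind_eq_ind_iff _ _).mp hyeq
      have hkmem : k ∈ insert b ({x} : Finset (TorusSite 3 L)) := by
        rw [← hsets]; simp
      rw [Finset.mem_insert, Finset.mem_singleton] at hkmem
      rcases hkmem with rfl | rfl
      · exact hbS (by rw [hS]; simp)
      · exact hxk rfl
    have hxterm : ∀ b : TorusSite 3 L,
        (if (b ∉ S ∧ (torusGraph 3 L).Adj x b) ∧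
            (fun z => if z ∈ insert b (S.erase x) then (0 : Fin 2) else 1) ∈ T then (1 : ℝ) else 0) ≤
          if (torusGraph 3 L).Adj x b then (1 : ℝ) else 0 := by
      intro b
      split_ifs with h1 h2
      · exact le_rfl
      · exact absurd h1.1.2 h2
      · norm_num
      · exact le_rfl
    have hdeg := torus_degree_le_six x
    have hsum6 : (∑ a ∈ S, ∑ b : TorusSite 3 L,
          (if (b ∉ S ∧ (torusGraph 3 L).Adj a b) ∧
            (fun z => if z ∈ insert b (S.erase a) then (0 : Fin 2) else 1) ∈ T then (1 : ℝ) else 0)) ≤ 6 := by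
      rw [hS, Finset.sum_insert (by simpa using hxk), Finset.sum_singleton, ← hS]
      rw [Finset.sum_congr rfl fun b _ => hkterm b, Finset.sum_const_zero, add_zero]
      calc (∑ b : TorusSite 3 L,
            (if (b ∉ S ∧ (torusGraph 3 L).Adj x b) ∧
              (fun z => if z ∈ insert b (S.erase x) then (0 : Fin 2) else 1) ∈ T then (1 : ℝ) else 0))
          ≤ ∑ b : TorusSite 3 L, (if (torusGraph 3 L).Adj x b then (1 : ℝ) else 0) :=
            Finset.sum_le_sum fun b _ => hxterm b
        _ = ((Finset.univ.filter fun y => (torusGraph 3 L).Adj x y).card : ℝ) := by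
            rw [Finset.sum_boole]
        _ ≤ 6 := by exact_mod_cast hdeg
    linarith
  -- `Re ⟨Φ, HΦ⟩ ≥ -3 #T`
  have hqf : -3 * (T.card : ℝ) ≤ (star Φ ⬝ᵥ (xyTorus 3 L 1 *ᵥ Φ)).re := by
    rw [dotProduct, Complex.re_sum]
    have hterm : ∀ σ : TensorIndex (TorusSite 3 L) 2,
        (if σ ∈ T then (-3 : ℝ) else 0) ≤ (star Φ σ * (xyTorus 3 L 1 *ᵥ Φ) σ).re := by
      intro σ
      rw [Pi.star_apply, hΦT σ]
      by_cases hσ : σ ∈ T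
      · rw [if_pos hσ, if_pos hσ, star_one, one_mul]
        obtain ⟨x, hx, rfl⟩ := Finset.mem_image.mp hσ
        exact hrow x (Finset.ne_of_mem_erase hx)
      · rw [if_neg hσ, if_neg hσ, star_zero, zero_mul, Complex.zero_re]
    calc -3 * (T.card : ℝ) = ∑ σ : TensorIndex (TorusSite 3 L) 2, (if σ ∈ T then (-3 : ℝ) else 0) := by
          rw [Finset.sum_ite_mem, Finset.univ_inter, Finset.sum_const, nsmul_eq_mul, mul_comm]
      _ ≤ _ := Finset.sum_le_sum fun σ _ => hterm σ
  -- `#T > 0`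
  have hTpos : 0 < T.card := by
    rw [hT, Finset.card_pos]
    have hcard : 0 < (Finset.univ.erase k).card := by
      rw [Finset.card_erase_of_mem (Finset.mem_univ _), Finset.card_univ, card_torusSite 3 L]
      have : 27 ≤ L ^ 3 := Nat.pow_le_pow_left hL3 3
      omega
    obtain ⟨x₀, hx₀⟩ := Finset.card_pos.mp hcard
    exact ⟨τ x₀, Finset.mem_image_of_mem _ hx₀⟩
  -- `E(2) ≤ -5`
  have hE := lowestEnergy_two_le_neg_five hL3
  rw [show (((2 : ℕ) : ℝ)) = ((1 + 1 : ℕ) : ℝ) by norm_num] at hE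
  -- assemble
  rw [hns] at key
  simp only [Complex.natCast_re] at key
  set ns : ℝ := (T.card : ℝ) with hnsdef
  set E : ℝ := lowestEnergyInSector 1 (xyTorus 3 L 1) (((1 + 1 : ℕ) : ℝ) - (L : ℝ) ^ 3 / 2) with hEdef
  set qf : ℝ := (star Φ ⬝ᵥ (xyTorus 3 L 1 *ᵥ Φ)).re with hqfdef
  have hnspos : (0 : ℝ) < ns := by rw [hnsdef]; exact_mod_cast hTpos
  have hL0 : (0 : ℝ) < (L : ℝ) ^ 3 := by positivity
  have h2 : 2 * ns ≤ C_B / (L : ℝ) ^ 3 * ns := by nlinarith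
  have h3 : (2 : ℝ) ≤ C_B / (L : ℝ) ^ 3 := le_of_mul_le_mul_right h2 hnspos
  rw [le_div_iff₀ hL0] at h3
  linarith


end Summit.AtomisticToContinuum.BoseEinsteinCondensation.Theorems.InsertionFieldDelocalisation.Negative

end
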